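import Summits.Ventures.HodgeRepro2.T6N43Main

/-!
# T6N43Toy — non-vacuity witnesses for the binders of `N43_main_U11` / `N43_main_U2` (README §10.5(ii)(c)/(d))

Two toy data on which the displays of T6N43Hyp.lean and the interface Props of T6N43Datum.lean hold
JOINTLY, so that the binder lists of the two mains are instantiable:
* `toyU11 : ArchDoublingDatum ℝ MemU11` — the Cartan line itself: `H = ℝ ∋ η`, `rep η = a_{η/2}` (p1's
  `hyperbolicC`, in U(1,1)), `μ = ½ sinh η dη` on η > 0 (Rühl's radial measure, so (A-2f) holds with
  c = 1), `coeffW = coeffπ = cosh(η/2)^{−3}` (the lowest-weight coefficient with ‖φ‖ = ‖f‖ = 1),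
  `Lfac` = the Eischen–Liu product for weight (0; 0) and twist 0;
* `toyU2 : ArchDoublingDatum Unit (· ∈ unitaryGroup)` — the trivial group with its probability measure.
These witness the BINDERS, not the theorem: on them `N43_main_*` applies and gives `Z^*(1/2) ≠ 0`
(`toyU11_zetaStar_ne_zero`), which is the expected behaviour of a non-vacuity datum for a theorem whose
content is the positivity of an explicit integral. §8(d): uses an L-value-free non-vanishing device: NO.
-/

namespace Summit.Ventures.HodgeRepro2.T6

open MeasureTheory Complex
open scoped NNReal ENNReal

namespace N43Toy

/-- The entries of `a_t = hyperbolicC t` are measurable functions of `t`. -/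
theorem measurable_hyperbolicC_entry (i j : Fin 2) :
    Measurable fun η : ℝ => T5UnitaryBound.hyperbolicC (η / 2) i j := by
  have hc : Measurable fun η : ℝ => ((Real.cosh (η / 2) : ℝ) : ℂ) :=
    (Complex.continuous_ofReal.comp (Real.continuous_cosh.comp (continuous_id.div_const 2))).measurable
  have hs : Measurable fun η : ℝ => ((Real.sinh (η / 2) : ℝ) : ℂ) :=
    (Complex.continuous_ofReal.comp (Real.continuous_sinh.comp (continuous_id.div_const 2))).measurable
  fin_cases i <;> fin_cases j <;> simp only [T5UnitaryBound.hyperbolicC, Matrix.of_apply,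
    Matrix.cons_val', Matrix.cons_val_fin_one, Fin.mk_one, Fin.isValue] <;>
    first | exact hc | exact hs

/-- The toy datum on the Cartan line (signature (1,1)). -/
noncomputable def toyU11 : ArchDoublingDatum ℝ T5UnitaryBound.MemU11 where
  μ := (volume.restrict (Set.Ioi (0 : ℝ))).withDensity (fun η => ENNReal.ofReal (1 / 2 * Real.sinh η))
  rep η := T5UnitaryBound.hyperbolicC (η / 2)
  rep_mem η := T5UnitaryBound.hyperbolicC_memU11 (η / 2)
  rep_measurable := measurable_hyperbolicC_entry
  coeffW η := ((Real.cosh ((2 * Real.arsinh ‖T5UnitaryBound.hyperbolicC (η / 2) 1 0‖) / 2) ^ (-3 : ℤ) : ℝ) : ℂ)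
  coeffπ η := ((Real.cosh ((2 * Real.arsinh ‖T5UnitaryBound.hyperbolicC (η / 2) 1 0‖) / 2) ^ (-3 : ℤ) : ℝ) : ℂ)
  normφ := 1
  normf := 1
  normφ_pos := one_pos
  normf_pos := one_pos
  Lfac s :=
    (∏ j : Fin 1, T5GammaFactor.GammaC
        (s + ((|((0 : Fin 1 → ℤ) j : ℝ) - ((0 : ℤ) : ℝ) / 2 + (((1 : ℕ) : ℝ) - ((1 : ℕ) : ℝ) + 1) / 2
          - ((j : ℕ) + 1)| : ℝ) : ℂ))) *
    (∏ j : Fin 1, T5GammaFactor.GammaC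
        (s + ((|((0 : Fin 1 → ℤ) j : ℝ) - ((0 : ℤ) : ℝ) / 2 + (((1 : ℕ) : ℝ) + ((1 : ℕ) : ℝ) + 1) / 2
          - ((j : ℕ) + 1)| : ℝ) : ℂ)))

/-- The toy satisfies (I-P2): its two coefficients coincide (‖φ‖ = ‖f‖ = 1). -/
theorem toyU11_fock : toyU11.FockLineIdentification := by
  intro g
  simp [toyU11]

/-- The toy satisfies (I-P2′): its coefficient is `cosh(η/2)^{−3}` by definition. -/
theorem toyU11_lowest : toyU11.LowestWeightCoefficient := by
  intro g
  simp only [toyU11, ArchDoublingDatum.eta, one_pow, one_mul]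
  rw [Complex.norm_real, Real.norm_eq_abs, abs_of_pos (zpow_pos (Real.cosh_pos _) _)]

/-- The toy's `Lfac` is the Eischen–Liu product for weight (0; 0) and twist 0, by definition. -/
theorem toyU11_EL : Hyp.EischenLiu2024_Sec2_2 1 1 0 0 0 toyU11.Lfac := fun _ => rfl

/-- On the support of the toy measure (η > 0) Rühl's parameter of `a_{η/2}` is η itself. -/
theorem toyU11_eta_eq {η : ℝ} (hη : 0 < η) : toyU11.eta η = η := by
  simp only [toyU11, ArchDoublingDatum.eta, T5UnitaryBound.hyperbolicC]
  simp only [Matrix.of_apply, Matrix.cons_val', Matrix.cons_val_zero, Matrix.cons_val_one,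
    Matrix.cons_val_fin_one, Fin.isValue]
  rw [Complex.norm_real, Real.norm_eq_abs, abs_of_pos (Real.sinh_pos_iff.mpr (by positivity)),
    Real.arsinh_sinh]
  ring

/-- The toy satisfies the (A-2f) display with `c = 1`: the push-forward of Rühl's radial measure under
`η` is itself (`toyU11_eta_eq` on the support). -/
theorem toyU11_A2f : Hyp.Ruhl1970_A2f toyU11 := by
  refine ⟨1, one_pos, ?_⟩
  rw [ENNReal.ofReal_one, one_smul]
  have hae : toyU11.eta =ᵐ[toyU11.μ] id := by
    have h1 : ∀ᵐ η ∂(volume.restrict (Set.Ioi (0 : ℝ))), η ∈ Set.Ioi (0 : ℝ) :=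
      ae_restrict_mem measurableSet_Ioi
    have h2 : ∀ᵐ η ∂toyU11.μ, η ∈ Set.Ioi (0 : ℝ) :=
      (withDensity_absolutelyContinuous _ _).ae_le h1
    filter_upwards [h2] with η hη
    exact toyU11_eta_eq hη
  rw [Measure.map_congr hae, Measure.map_id]
  rfl

/-- README §10.5(ii)(d) for `N43_main_U11`: its four binders are jointly satisfiable. -/
theorem binders_U11_jointly_satisfiable :
    ∃ 𝒟 : ArchDoublingDatum ℝ T5UnitaryBound.MemU11, 𝒟.FockLineIdentification ∧
      𝒟.LowestWeightCoefficient ∧ Hyp.Ruhl1970_A2f 𝒟 ∧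
      Hyp.EischenLiu2024_Sec2_2 1 1 0 0 0 𝒟.Lfac :=
  ⟨toyU11, toyU11_fock, toyU11_lowest, toyU11_A2f, toyU11_EL⟩

/-- The theorem applied to the toy: `Z^*(1/2) ≠ 0` on the Cartan line. -/
theorem toyU11_zetaStar_ne_zero : toyU11.zetaStar (1 / 2) ≠ 0 :=
  (toyU11.N43_main_U11 toyU11_fock toyU11_lowest toyU11_A2f toyU11_EL).2

/-- The toy datum at the compact place: the trivial group. -/
noncomputable def toyU2 : ArchDoublingDatum Unit (· ∈ Matrix.unitaryGroup (Fin 2) ℂ) where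
  μ := Measure.dirac ()
  rep _ := 1
  rep_mem _ := Submonoid.one_mem _
  rep_measurable _ _ := measurable_const
  coeffW _ := 1
  coeffπ _ := 1
  normφ := 1
  normf := 1
  normφ_pos := one_pos
  normf_pos := one_pos
  Lfac s :=
    (∏ j : Fin 2, T5GammaFactor.GammaC
        (s + ((|((0 : Fin 2 → ℤ) j : ℝ) - ((0 : ℤ) : ℝ) / 2 + (((2 : ℕ) : ℝ) - ((0 : ℕ) : ℝ) + 1) / 2
          - ((j : ℕ) + 1)| : ℝ) : ℂ))) *
    (∏ j : Fin 0, T5GammaFactor.GammaC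
        (s + ((|((0 : Fin 0 → ℤ) j : ℝ) - ((0 : ℤ) : ℝ) / 2 + (((2 : ℕ) : ℝ) + ((0 : ℕ) : ℝ) + 1) / 2
          - ((j : ℕ) + 1)| : ℝ) : ℂ)))

/-- The compact toy satisfies (I-P2) at τ′₁ with `m = 0`. -/
theorem toyU2_char : toyU2.CharacterCoefficient 0 := by
  constructor <;> intro g <;> simp [toyU2]

/-- The compact toy's `Lfac` is the Eischen–Liu product for `(a, b) = (2, 0)`, weight (0, 0; ∅), twist 0. -/
theorem toyU2_EL : Hyp.EischenLiu2024_Sec2_2 2 0 0 0 0 toyU2.Lfac := fun _ => rfl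

/-- README §10.5(ii)(d) for `N43_main_U2`: its binders are jointly satisfiable. -/
theorem binders_U2_jointly_satisfiable :
    ∃ 𝒟 : ArchDoublingDatum Unit (· ∈ Matrix.unitaryGroup (Fin 2) ℂ), IsProbabilityMeasure 𝒟.μ ∧
      𝒟.CharacterCoefficient 0 ∧ Hyp.EischenLiu2024_Sec2_2 2 0 0 0 0 𝒟.Lfac :=
  ⟨toyU2, inferInstanceAs (IsProbabilityMeasure (Measure.dirac ())), toyU2_char, toyU2_EL⟩

end N43Toy

end Summit.Ventures.HodgeRepro2.T6
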